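import Summits.CriticalPhenomena.PercolationContinuityZ3.Theorems.PercNearOneGluingNoHeavyLowerTailTwoPartitionWeightedBaseRays
import Summits.CriticalPhenomena.PercolationContinuityZ3.Theorems.PercNearOneGluingNoHeavyLowerTailTwoPartitionKey
import HarnessLib.Audit

/-!
# `NoHeavyLowerTail` (crux stmt-CriticalPhenomena-4575), master-family hierarchy P3 (gen 27): `KeyIneq → WB4` by a termwise identity —
# the one-sided sandwich inequality KEY implies the extreme-ray inequality of the weighted base, hence `WeightedBase`, `ThreeSetAntipodal`, SQKD

Support file (seat `prim-masterthm-p3`; `--supports stmt-CriticalPhenomena-4575`; memo `FROM-prim-masterthm-p3-g27-KEY-TWO-LAYER.md` §5,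
`KEY-REDUCTION-g26.md` §3–4).

THE STEP.  For up-sets `ℰ ⊆ 𝒜`, `ℬ`, `𝒞` the `WB4` expression is an IDENTITY in three Harris–Kleitman sandwiches (`twoPartN 𝒳 𝒵 = #(𝒳∩𝒵) − #(𝒳∩𝒵ᶜˢ)`):

  `2#(𝒜ℬ𝒞) + #(ℰℬ𝒞ᶜˢ) + #(ℰ𝒞ℬᶜˢ) − #(𝒜ℬ𝒞ᶜˢ) − #(𝒜𝒞ℬᶜˢ) − 2#(ℰℬᶜˢ𝒞ᶜˢ)
     = 2·twoPartN ℰ (ℬ∩𝒞) + [twoPartN (𝒜∩ℬ) 𝒞 − twoPartN (ℰ∩ℬ) 𝒞] + [twoPartN (𝒜∩𝒞) ℬ − twoPartN (ℰ∩𝒞) ℬ]`      (`wb4_expr_eq`),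

and each bracket is `≥ −twoPartN ℰ (ℬ∩𝒞)` by the form `KeyForm` of KEY: for up-sets `𝒳 ⊆ ℬ`, `ℰ`, `𝒞`,
`twoPartN (𝒳∩ℰ) 𝒞 − twoPartN 𝒳 𝒞 ≤ twoPartN ℰ (ℬ∩𝒞)` (take `𝒳 = 𝒜∩ℬ`, resp. swap `ℬ ↔ 𝒞`).  `KeyForm` follows from `KeyIneq` (gen 26's form,
`…TwoPartitionKey`) by taking `𝒴 = 𝒳 ∪ ℰ`: the members of `𝒳 ∖ ℰ` have all their `𝒴`-predecessors in `ℬ` (`keyForm_of_keyIneq`).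
So, in the kernel: **`KeyIneq → KeyForm → WB4 → WeightedBase → ThreeSetAntipodal`** (`threeSetAntipodal_of_keyIneq`), and with `…TwoPartitionFibre`
SQKD for every product measure.  (Gen 26 reached `WB4` from KEY through Picard's closure duality; the termwise identity makes that unnecessary.)
HONEST LABEL: a reduction between open statements (all conjectures are `@[conjecture]` defs elsewhere); nothing here bears on the crux. [this work]
-/

namespace Summit.CriticalPhenomena.PercolationContinuityZ3.Theorems.TwoPartition

open Finset
open scoped FinsetFamily

variable {α : Type*} [DecidableEq α] [Fintype α]

/-- **`KeyForm`** (gen 26 Lemma 7 form of KEY; open): for up-sets `𝒳 ⊆ ℬ`, `ℰ`, `𝒞` of a finite cube,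
`twoPartN (𝒳 ∩ ℰ) 𝒞 − twoPartN 𝒳 𝒞 ≤ twoPartN ℰ (ℬ ∩ 𝒞)`.  Implied by `KeyIneq` (`keyForm_of_keyIneq`); implies `WB4` (`wb4_of_keyForm`).
An obligation / hypothesis — never a fact. [this work] [status: open] -/
@[conjecture] def KeyForm : Prop :=
  ∀ (n : ℕ) (𝒳 ℰ ℬ 𝒞 : Finset (Finset (Fin n))), IsUpperSet (𝒳 : Set (Finset (Fin n))) → IsUpperSet (ℰ : Set (Finset (Fin n))) →
    IsUpperSet (ℬ : Set (Finset (Fin n))) → IsUpperSet (𝒞 : Set (Finset (Fin n))) → 𝒳 ⊆ ℬ →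
      twoPartN (𝒳 ∩ ℰ) 𝒞 - twoPartN 𝒳 𝒞 ≤ twoPartN ℰ (ℬ ∩ 𝒞)

/-! ### The identity behind `WB4` -/

omit [Fintype α] in
/-- The `WB4` expression as a combination of three sandwiches (pure counting, `ℰ ⊆ 𝒜` not even needed). [this work] -/
theorem wb4_expr_eq [Fintype α] (𝒜 ℰ ℬ 𝒞 : Finset (Finset α)) :
    (2 * #(𝒜 ∩ ℬ ∩ 𝒞) + #(ℰ ∩ ℬ ∩ 𝒞ᶜˢ) + #(ℰ ∩ 𝒞 ∩ ℬᶜˢ) - #(𝒜 ∩ ℬ ∩ 𝒞ᶜˢ) - #(𝒜 ∩ 𝒞 ∩ ℬᶜˢ) - 2 * #(ℰ ∩ ℬᶜˢ ∩ 𝒞ᶜˢ) : ℤ)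
      = 2 * twoPartN ℰ (ℬ ∩ 𝒞) + (twoPartN (𝒜 ∩ ℬ) 𝒞 - twoPartN (ℰ ∩ ℬ) 𝒞) + (twoPartN (𝒜 ∩ 𝒞) ℬ - twoPartN (ℰ ∩ 𝒞) ℬ) := by
  unfold twoPartN
  rw [compls_inter]
  have e1 : ℰ ∩ (ℬ ∩ 𝒞) = ℰ ∩ ℬ ∩ 𝒞 := (inter_assoc _ _ _).symm
  have e2 : ℰ ∩ (ℬᶜˢ ∩ 𝒞ᶜˢ) = ℰ ∩ ℬᶜˢ ∩ 𝒞ᶜˢ := (inter_assoc _ _ _).symm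
  have e3 : 𝒜 ∩ 𝒞 ∩ ℬ = 𝒜 ∩ ℬ ∩ 𝒞 := by ext; simp [and_comm]
  have e4 : ℰ ∩ 𝒞 ∩ ℬ = ℰ ∩ ℬ ∩ 𝒞 := by ext; simp [and_comm]
  rw [e1, e2, e3, e4]
  ring

/-- **`KeyForm ⟹ WB4`** (this work): by the identity `wb4_expr_eq` and two applications of `KeyForm` (to `𝒳 = 𝒜 ∩ ℬ` and, with `ℬ ↔ 𝒞`
swapped, to `𝒳 = 𝒜 ∩ 𝒞`). [this work] -/
theorem wb4_of_keyForm (h : KeyForm) : WB4 := by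
  intro n 𝒜 ℰ ℬ 𝒞 h𝒜 hℰ hℬ h𝒞 hEA
  have hAB : IsUpperSet ((𝒜 ∩ ℬ : Finset (Finset (Fin n))) : Set (Finset (Fin n))) := by
    rw [Finset.coe_inter]; exact h𝒜.inter hℬ
  have hAC : IsUpperSet ((𝒜 ∩ 𝒞 : Finset (Finset (Fin n))) : Set (Finset (Fin n))) := by
    rw [Finset.coe_inter]; exact h𝒜.inter h𝒞
  have k1 := h n (𝒜 ∩ ℬ) ℰ ℬ 𝒞 hAB hℰ hℬ h𝒞 inter_subset_right
  have k2 := h n (𝒜 ∩ 𝒞) ℰ 𝒞 ℬ hAC hℰ h𝒞 hℬ inter_subset_right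
  have i1 : 𝒜 ∩ ℬ ∩ ℰ = ℰ ∩ ℬ := by
    ext S; simp only [mem_inter]
    exact ⟨fun h => ⟨h.2, h.1.2⟩, fun h => ⟨⟨hEA h.1, h.2⟩, h.1⟩⟩
  have i2 : 𝒜 ∩ 𝒞 ∩ ℰ = ℰ ∩ 𝒞 := by
    ext S; simp only [mem_inter]
    exact ⟨fun h => ⟨h.2, h.1.2⟩, fun h => ⟨⟨hEA h.1, h.2⟩, h.1⟩⟩
  rw [i1] at k1; rw [i2, inter_comm 𝒞 ℬ] at k2
  have e := wb4_expr_eq 𝒜 ℰ ℬ 𝒞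
  have hE := twoPartN_nonneg hℰ (show IsUpperSet ((ℬ ∩ 𝒞 : Finset (Finset (Fin n))) : Set (Finset (Fin n))) by
    rw [Finset.coe_inter]; exact hℬ.inter h𝒞)
  linarith

/-! ### `KeyIneq ⟹ KeyForm` -/

/-- **`KeyIneq ⟹ KeyForm`** (this work).  With `𝒴 := 𝒳 ∪ ℰ`: every member of `𝒳 ∖ ℰ` has all its `𝒴`-subsets in `𝒳 ⊆ ℬ`, so `KeyIneq`
bounds `#{S ∈ 𝒳 ∖ ℰ : Sᶜ ∈ 𝒞 ∖ ℬ}` by `twoPartN 𝒴 (ℬ∩𝒞)`; the rest is counting. [this work] -/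
theorem keyForm_of_keyIneq (h : KeyIneq) : KeyForm := by
  intro n 𝒳 ℰ ℬ 𝒞 h𝒳 hℰ hℬ h𝒞 hXB
  set 𝒴 : Finset (Finset (Fin n)) := 𝒳 ∪ ℰ with hY
  have h𝒴 : IsUpperSet (𝒴 : Set (Finset (Fin n))) := by rw [hY, Finset.coe_union]; exact h𝒳.union hℰ
  have hk := h n 𝒴 ℬ 𝒞 h𝒴 hℬ h𝒞
  -- the filter in `KeyIneq` contains (𝒳 \ ℰ) ∩ {Sᶜ ∈ 𝒞 \ ℬ}
  set 𝒟 : Finset (Finset (Fin n)) := (𝒳 \ ℰ).filter fun S => Sᶜ ∈ 𝒞 ∧ Sᶜ ∉ ℬ with hD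
  have hDsub : 𝒟 ⊆ 𝒴.filter fun S => (∀ T ∈ 𝒴, T ⊆ S → T ∈ ℬ) ∧ Sᶜ ∈ 𝒞 ∧ Sᶜ ∉ ℬ := by
    intro S hS
    rw [hD, mem_filter, mem_sdiff] at hS
    rw [mem_filter]
    refine ⟨mem_union_left _ hS.1.1, fun T hT hTS => ?_, hS.2.1, hS.2.2⟩
    rcases mem_union.1 hT with hTX | hTE
    · exact hXB hTX
    · exact absurd (hℰ hTS hTE) hS.1.2
  have hcard := card_le_card hDsub
  -- counting: write everything over the partition 𝒴 = ℰ ⊔ (𝒳 \ ℰ)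
  have hdisj : Disjoint ℰ (𝒳 \ ℰ) := disjoint_sdiff
  have hYsplit : 𝒴 = ℰ ∪ (𝒳 \ ℰ) := by
    rw [hY]; ext S; simp only [mem_union, mem_sdiff]; tauto
  have c1 : #(𝒴 ∩ ℬ ∩ 𝒞) = #(ℰ ∩ (ℬ ∩ 𝒞)) + #((𝒳 \ ℰ) ∩ (ℬ ∩ 𝒞)) := by
    rw [hYsplit, inter_assoc, union_inter_distrib_right, card_union_of_disjoint (hdisj.mono inter_subset_left inter_subset_left)]
  have c2 : #(𝒴 ∩ (ℬ ∩ 𝒞)ᶜˢ) = #(ℰ ∩ (ℬ ∩ 𝒞)ᶜˢ) + #((𝒳 \ ℰ) ∩ (ℬ ∩ 𝒞)ᶜˢ) := by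
    rw [hYsplit, union_inter_distrib_right, card_union_of_disjoint (hdisj.mono inter_subset_left inter_subset_left)]
  -- twoPartN 𝒳 𝒞 = twoPartN (𝒳 ∩ ℰ) 𝒞 + (counts over 𝒳 \ ℰ)
  have hXsplit : 𝒳 = (𝒳 ∩ ℰ) ∪ (𝒳 \ ℰ) := by ext S; simp only [mem_union, mem_inter, mem_sdiff]; tauto
  have hdisj2 : Disjoint (𝒳 ∩ ℰ) (𝒳 \ ℰ) := disjoint_sdiff.mono_left inter_subset_right
  have c3 : #(𝒳 ∩ 𝒞) = #(𝒳 ∩ ℰ ∩ 𝒞) + #((𝒳 \ ℰ) ∩ 𝒞) := by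
    conv_lhs => rw [hXsplit]
    rw [union_inter_distrib_right, card_union_of_disjoint (hdisj2.mono inter_subset_left inter_subset_left)]
  have c4 : #(𝒳 ∩ 𝒞ᶜˢ) = #(𝒳 ∩ ℰ ∩ 𝒞ᶜˢ) + #((𝒳 \ ℰ) ∩ 𝒞ᶜˢ) := by
    conv_lhs => rw [hXsplit]
    rw [union_inter_distrib_right, card_union_of_disjoint (hdisj2.mono inter_subset_left inter_subset_left)]
  -- on 𝒳 \ ℰ ⊆ ℬ: (𝒳\ℰ) ∩ 𝒞 = (𝒳\ℰ) ∩ (ℬ∩𝒞) and (𝒳\ℰ) ∩ 𝒞ᶜˢ = (𝒳\ℰ) ∩ (ℬ∩𝒞)ᶜˢ ⊔ 𝒟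
  have c5 : (𝒳 \ ℰ) ∩ 𝒞 = (𝒳 \ ℰ) ∩ (ℬ ∩ 𝒞) := by
    ext S; simp only [mem_inter, mem_sdiff]
    exact ⟨fun hh => ⟨hh.1, hXB hh.1.1, hh.2⟩, fun hh => ⟨hh.1, hh.2.2⟩⟩
  have c6 : #((𝒳 \ ℰ) ∩ 𝒞ᶜˢ) = #((𝒳 \ ℰ) ∩ (ℬ ∩ 𝒞)ᶜˢ) + #𝒟 := by
    have := card_filter_add_card_filter_not (s := (𝒳 \ ℰ) ∩ 𝒞ᶜˢ) (fun S => Sᶜ ∈ ℬ)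
    have f1 : ((𝒳 \ ℰ) ∩ 𝒞ᶜˢ).filter (fun S => Sᶜ ∈ ℬ) = (𝒳 \ ℰ) ∩ (ℬ ∩ 𝒞)ᶜˢ := by
      ext S; simp only [mem_filter, mem_inter, mem_compls]; tauto
    have f2 : ((𝒳 \ ℰ) ∩ 𝒞ᶜˢ).filter (fun S => ¬ Sᶜ ∈ ℬ) = 𝒟 := by
      rw [hD]; ext S; simp only [mem_filter, mem_inter, mem_compls]; tauto
    rw [f1, f2] at this
    omega
  unfold twoPartN
  rw [c3, c4, c5, c6]
  rw [c1, c2] at hk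
  push_cast at hk ⊢
  have hc : (#𝒟 : ℤ) ≤ #(𝒴.filter fun S => (∀ T ∈ 𝒴, T ⊆ S → T ∈ ℬ) ∧ Sᶜ ∈ 𝒞 ∧ Sᶜ ∉ ℬ) := by exact_mod_cast hcard
  linarith

/-- **`KeyIneq ⟹ ThreeSetAntipodal`** (this work): the kernel chain `KeyIneq → KeyForm → WB4 → WeightedBase → ThreeSetAntipodal`. [this work] -/
theorem threeSetAntipodal_of_keyIneq (h : KeyIneq) : ThreeSetAntipodal :=
  threeSetAntipodal_of_weightedBase (weightedBase_of_wb4 (wb4_of_keyForm (keyForm_of_keyIneq h)))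

end Summit.CriticalPhenomena.PercolationContinuityZ3.Theorems.TwoPartition
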